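import Summits.QuantumFields.BalabanUV.Beta.GAN24.EnvelopeBlockSum
import Summits.QuantumFields.BalabanUV.Beta.GAN24.TransversalZeroMode

/-!
# `BalabanUV.Beta.GAN24.StaircaseFaces` — binder row G-an2-4 / (CONV-C), CT-ROUTE (owner's design `gen17/CT-ROUTE-v1.md`, refined `gen18/CT3-MECHANISM.md`
# v1.1 §(b)), STEP CT-3b1: THE LATTICE TOOLKIT OF THE TWO-GAUGE ∕ DRESSED-PARTNER PAIRING — gradients of block-constant («staircase») functions live on
# the block faces; the EXACT face fraction `P⁻¹` of a block-constant weight; summation by parts on `ℤ^{d+1}`; the gradient of the tent force `𝒬ᵀφ`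

NOT IN PRINT; OUR PROOF ATTEMPT (row owner `b2b-balaban-gan24-p1`, gen 18; journal `CLAIMS.log` INTENT «CT-3b» l.31278).  [folklore] real analysis and counting on
`ℤ^{d+1}`; 0 cited facts, 0 `def`, 0 `def … : Prop`, 0 sorry.  HONEST FRAMING (cell contract, verbatim): «discharging `BetaPertH` makes Bałaban's UV stability
UNCONDITIONAL — a real constructive-QFT result; it is NOT the continuum limit and NOT the Clay problem.»  HONEST DEPENDENCY (verbatim): «continuum YM on T⁴ ⇐
BetaPertH ∧ nine spine estimates (0/9 proved); BetaPertH ⇐ (D1) ∧ (D4) ∧ CAP+tail; G-an2-4 gates asym, D1 and NE2/3/4.»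

## Why (CT3-MECHANISM v1.1 §(b))
The two-gauge ∕ dressed-partner term of the contact expansion is the pairing `Σ'_{κ,u} t_κ(u)·ψ̄(κ,u)·(Δ_κχ)(u)` of the tent force `t = 𝒬ᵀ_N φ` with two STAIRCASE SUMS
`ψ = Σ_s λ^{(s)}`, `χ = Σ_s μ^{(s)}`, `λ^{(s)} = g_s ∘ blk (Lc^s)`.  Its log-free bound («differentiate the coarser factor», module CT-3b2 `StaircasePairing`) rests on four
facts typed here: (F1) `Δ_κ(g ∘ blk P)` vanishes off the `P`-faces `{u : P ∣ u_κ + 1}` (§1); (F2) against a `P`-block-constant summable weight the faces carry EXACTLY the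
fraction `P⁻¹` of the mass (§2); (F3) summation by parts moves `Δ_κ` between the factors (§3); (F4) the tent force's gradient along its own direction is the coarse
difference `φ_κ(q) − φ_κ(q − e_κ)`, `q = quo N (u + e_κ)` — its mass is `1∕N` of the force's (§4).

## Contents (generic `d`; `blk`, `quo`, `dz`, `contourSumAdj`, `supNorm`, `box`, `toSite` of the tree)
* §1 `emod_add_one_lt_of_not_dvd`, `add_one_ediv_of_not_dvd`, `blk_add_unitVec_of_not_dvd`, **`dz_comp_blk_eq_zero`** (F1), `blk_one`.
* §2 `card_box_filter_last` (`#{r ∈ box P : r κ = P−1} = P^d`), `dvd_toSite_add_one_iff`, **`tsum_ite_dvd_eq`** (F2): for `F` summable and constant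
  on the `P`-blocks, `Σ'_u (if P ∣ u_κ+1 then F u else 0) = P⁻¹ · Σ'_u F u`.
* §3 **`tsum_mul_dz_eq`** (F3): `Σ'_u A u·(g(u+e_κ) − g u) = Σ'_u g u·(A(u − e_κ) − A u)` (both products summable).
* §4 the labels one step away (`quo_add_unitVec_apply_ne`, `quo_apply_le_quo_add_unitVec_apply`, `quo_add_unitVec_apply_le`, `supNorm_quo_add_unitVec_sub_le_one`),
  **`contourSumAdj_add_unitVec_sub`** (F4: `𝒬ᵀφ_κ(u+e_κ) − 𝒬ᵀφ_κ(u) = φ_κ(quo N (u+e_κ)) − φ_κ(quo N (u+e_κ) − e_κ)`), and its envelope form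
  `abs_contourSumAdj_add_unitVec_sub_le` (`≤ 2Φ₀e^{2κ₀}·e^{−κ₀‖quo N u − y₀‖∞}` — NO factor `N`: the gradient mass of the tent is `1∕N` of its mass).
* §5 one-step wobble of the block-scale envelopes `e^{−κ₀‖quo N u − c‖∞}` (`env_add_unitVec_le`, `env_sub_unitVec_le`, `env_le_exp_mul_env_add_unitVec`; leaf-12's
  `EnvelopeBlockSum.env_wobble` at `|e_κ|₁ = 1`), `quo_quo`, and their constancy on every sub-block `quo_zsmul_add_toSite_of_dvd` (`P ∣ N`).
Discharges NO slot letter; asserts NO shape of Bałaban's stencils; 0 wall binders; NEVER «G-an2-4 closed»; NOT D1, NOT BetaPertH, NOT continuum, NOT Clay.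
-/

noncomputable section

open Finset
open scoped BigOperators
open Literature.MathematicalPhysics.QuantumFieldTheory
open Literature.MathematicalPhysics.QuantumFieldTheory.LatticeForm (quo)
open Literature.MathematicalPhysics.QuantumFieldTheory.Balaban1983to89
open Literature.MathematicalPhysics.QuantumFieldTheory.Balaban1983to89.Beta
open B4ContourShift (supNorm abs_le_supNorm supNorm_nonneg)
open B4Reflection242 (supNorm_le_of_forall supNorm_add_le)
open B12Sec2to5 (l1 l1_nonneg)
open AffineAveraging (Form0 Form1 Site box toSite unitVec unitVec_apply dz)
open AffineReproduction (contourSumAdj)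
open AveragingContours (blk)
open BlochFibreUniqueness (quo_add_zsmul)
open KKTFluctuationEnergy (contourSumAdj_eq quo_zsmul_add_toSite)
open Summit.QuantumFields.BalabanUV.Beta.GAN24.EnvelopeBlockSum (env_wobble)
open Summit.QuantumFields.BalabanUV.Beta.GAN24.BiStencilZeroMode (tsum_eq_sum_box_tsum tsum_mul_periodic)
open Summit.QuantumFields.BalabanUV.Beta.GAN24.TransversalZeroMode (card_box_succ)

namespace Summit.QuantumFields.BalabanUV.Beta.GAN24.StaircaseFaces

variable {d : ℕ}

/-! ## §1 (F1) Gradients of block-constant functions live on the block faces -/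

/-- [folklore] If `P ∤ a + 1` then the remainder of `a` is not the last one: `a % P + 1 < P` (`0 < P`). -/
theorem emod_add_one_lt_of_not_dvd {P a : ℤ} (hP : 0 < P) (h : ¬ P ∣ a + 1) : a % P + 1 < P := by
  have hlt : a % P < P := Int.emod_lt_of_pos a hP
  rcases lt_or_eq_of_le (show a % P + 1 ≤ P by omega) with hl | he
  · exact hl
  · exfalso
    apply h
    refine ⟨a / P + 1, ?_⟩
    have h1 := Int.emod_add_ediv_mul a P
    linear_combination -h1 + he

/-- [folklore] … hence one step does not change the quotient: `(a + 1) / P = a / P` (`0 < P`, `P ∤ a + 1`). -/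
theorem add_one_ediv_of_not_dvd {P a : ℤ} (hP : 0 < P) (h : ¬ P ∣ a + 1) : (a + 1) / P = a / P := by
  have hr := emod_add_one_lt_of_not_dvd hP h
  have h0 : 0 ≤ a % P := Int.emod_nonneg a hP.ne'
  have h1 := Int.emod_add_ediv_mul a P
  exact ((Int.ediv_emod_unique hP).2 ⟨by linear_combination h1, by omega, hr⟩).1

/-- [folklore] Off the `P`-faces one step in direction `κ` keeps the block label: `P ∤ u_κ + 1 ⇒ blk P (u + e_κ) = blk P u`. -/
theorem blk_add_unitVec_of_not_dvd {P : ℕ} (hP : 1 ≤ P) {u : Site (d + 1)} {κ : Fin (d + 1)} (h : ¬ ((P : ℤ) ∣ u κ + 1)) :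
    blk P (u + unitVec κ) = blk P u := by
  have hP' : (0 : ℤ) < P := by exact_mod_cast hP
  funext j
  simp only [blk, Pi.add_apply, unitVec_apply]
  by_cases hj : j = κ
  · subst hj; rw [if_pos rfl]; exact add_one_ediv_of_not_dvd hP' h
  · rw [if_neg hj, add_zero]

/-- [folklore] **(F1) THE GRADIENT OF A BLOCK-CONSTANT FUNCTION VANISHES OFF THE FACES**: `P ∤ u_κ + 1 ⇒ dz (g ∘ blk P) κ u = 0`. -/
theorem dz_comp_blk_eq_zero {P : ℕ} (hP : 1 ≤ P) (g : Form0 (d + 1) ℝ) {u : Site (d + 1)} {κ : Fin (d + 1)} (h : ¬ ((P : ℤ) ∣ u κ + 1)) :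
    dz (fun x => g (blk P x)) κ u = 0 := by
  simp only [dz, blk_add_unitVec_of_not_dvd hP h, sub_self]

/-- [folklore] The trivial blocking: `blk 1 = id` (the scale-`0` piece of a staircase sum is an arbitrary function). -/
theorem blk_one (x : Site (d + 1)) : blk 1 x = x := by
  funext j; simp [blk]

/-! ## §2 (F2) The exact face fraction -/

/-- [folklore] The last `κ`-layer of the box: `#{r ∈ box (d+1) P : r κ = P − 1} = P^d` (`1 ≤ P`). -/
theorem card_box_filter_last {P : ℕ} (hP : 1 ≤ P) (κ : Fin (d + 1)) :
    ((box (d + 1) P).filter (fun r => r κ = P - 1)).card = P ^ d := by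
  have hmem : P - 1 ∈ Finset.range P := Finset.mem_range.2 (by omega)
  have h := Fintype.card_filter_piFinset_const_eq_of_mem (ι := Fin (d + 1)) (Finset.range P) κ hmem
  rw [Finset.card_range, Fintype.card_fin, Nat.add_sub_cancel] at h
  exact h

/-- [folklore] Inside the box, `P ∣ (toSite r)_κ + 1 ↔ r_κ = P − 1` (`1 ≤ P`, `r ∈ box P`). -/
theorem dvd_toSite_add_one_iff {P : ℕ} (hP : 1 ≤ P) {r : Fin (d + 1) → ℕ} (hr : r ∈ box (d + 1) P) (κ : Fin (d + 1)) :
    (P : ℤ) ∣ toSite r κ + 1 ↔ r κ = P - 1 := by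
  have hrκ : r κ < P := Finset.mem_range.1 (Fintype.mem_piFinset.1 hr κ)
  simp only [toSite]
  constructor
  · rintro ⟨c, hc⟩
    have hP' : (0 : ℤ) < P := by exact_mod_cast hP
    have hc1 : (0 : ℤ) < c := by nlinarith
    have hc2 : c < 2 := by nlinarith
    have : c = 1 := by omega
    subst this
    omega
  · intro h
    refine ⟨1, ?_⟩
    rw [h]; push_cast [Nat.cast_sub hP]; ring

/-- [folklore] **(F2) THE EXACT FACE FRACTION**: for a summable weight `F` constant on the `P`-blocks (`F (P•w + r) = F (P•w)`, `r ∈ box P`) the `κ`-faces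
`{u : P ∣ u_κ + 1}` carry exactly `P⁻¹` of its mass: `Σ'_u (if P ∣ u_κ + 1 then F u else 0) = P⁻¹ · Σ'_u F u` (cell decomposition at scale `P`: each block has `P^{d+1}`
sites of which `P^d` lie on its last `κ`-layer). -/
theorem tsum_ite_dvd_eq {P : ℕ} (hP : 1 ≤ P) {F : Site (d + 1) → ℝ} (hF : Summable F)
    (hconst : ∀ (w : Site (d + 1)) (r : Fin (d + 1) → ℕ), r ∈ box (d + 1) P → F ((P : ℤ) • w + toSite r) = F ((P : ℤ) • w)) (κ : Fin (d + 1)) :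
    ∑' u, (if (P : ℤ) ∣ u κ + 1 then F u else 0) = ((P : ℝ))⁻¹ * ∑' u, F u := by
  haveI : NeZero P := ⟨by omega⟩
  have hP0 : (P : ℝ) ≠ 0 := by exact_mod_cast (NeZero.ne P)
  set χ : Site (d + 1) → ℝ := fun u => if (P : ℤ) ∣ u κ + 1 then 1 else 0 with hχ
  have hper : ∀ u t : Site (d + 1), χ (u + (P : ℤ) • t) = χ u := by
    intro u t
    have e : (u + (P : ℤ) • t) κ + 1 = (P : ℤ) * t κ + (u κ + 1) := by
      simp only [Pi.add_apply, Pi.smul_apply, smul_eq_mul]; ring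
    simp only [hχ, e, dvd_add_right (dvd_mul_right (P : ℤ) (t κ))]
  have hFχ : (fun u => if (P : ℤ) ∣ u κ + 1 then F u else 0) = fun u => F u * χ u := by
    funext u; simp only [hχ]; split_ifs <;> simp
  have hs : Summable fun u => F u * χ u := by
    refine Summable.of_norm_bounded hF.norm (fun u => ?_)
    simp only [hχ]; split_ifs <;> simp
  rw [hFχ, tsum_mul_periodic (N := P) hper hs, tsum_eq_sum_box_tsum (N := P) hF]
  -- every cell sum is the same number `S`
  set S : ℝ := ∑' t : Site (d + 1), F ((P : ℤ) • t) with hS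
  have hcell : ∀ r ∈ box (d + 1) P, ∑' t : Site (d + 1), F ((P : ℤ) • t + toSite r) = S := fun r hr =>
    tsum_congr fun t => hconst t r hr
  -- the indicator sum over the box is the cardinality of the last `κ`-layer
  have hind : ∑ r ∈ box (d + 1) P, χ (toSite r) = (((box (d + 1) P).filter (fun r => r κ = P - 1)).card : ℝ) := by
    rw [Finset.card_eq_sum_ones, Nat.cast_sum, Finset.sum_filter]
    refine Finset.sum_congr rfl fun r hr => ?_
    simp only [hχ, dvd_toSite_add_one_iff hP hr κ]
    split_ifs <;> simp
  have hL : ∑ r ∈ box (d + 1) P, χ (toSite r) * ∑' t : Site (d + 1), F ((P : ℤ) • t + toSite r) = ((P : ℝ) ^ d) * S := by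
    rw [Finset.sum_congr rfl fun r hr => by rw [hcell r hr], ← Finset.sum_mul, hind, card_box_filter_last hP κ]
    push_cast; ring
  have hR : ∑ r ∈ box (d + 1) P, ∑' t : Site (d + 1), F ((P : ℤ) • t + toSite r) = ((P : ℝ) ^ (d + 1)) * S := by
    rw [Finset.sum_congr rfl fun r hr => hcell r hr, Finset.sum_const, card_box_succ, nsmul_eq_mul]
    push_cast; ring
  rw [hL, hR, pow_succ]
  field_simp

/-! ## §3 (F3) Summation by parts on `ℤ^{d+1}` -/

/-- [folklore] **(F3) SUMMATION BY PARTS** along direction `κ`: `Σ'_u A u·(g(u+e_κ) − g u) = Σ'_u g u·(A(u − e_κ) − A u)` whenever both products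
`A·g(·+e_κ)` and `A·g` are summable (translation invariance of the lattice sum). -/
theorem tsum_mul_dz_eq (A g : Site (d + 1) → ℝ) (κ : Fin (d + 1)) (h1 : Summable fun u => A u * g (u + unitVec κ))
    (h2 : Summable fun u => A u * g u) :
    ∑' u, A u * (g (u + unitVec κ) - g u) = ∑' u, g u * (A (u - unitVec κ) - A u) := by
  have ecomp : ((fun v : Site (d + 1) => A (v - unitVec κ) * g v) ∘ (Equiv.addRight (unitVec κ)))
      = fun u => A u * g (u + unitVec κ) := by
    funext u; simp only [Function.comp_apply, Equiv.coe_addRight, add_sub_cancel_right]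
  have hshift : ∑' u, A u * g (u + unitVec κ) = ∑' v, A (v - unitVec κ) * g v := by
    rw [← ecomp]
    exact Equiv.tsum_eq (Equiv.addRight (unitVec κ)) (fun v => A (v - unitVec κ) * g v)
  have h1' : Summable fun v : Site (d + 1) => A (v - unitVec κ) * g v := by
    rw [← Equiv.summable_iff (Equiv.addRight (unitVec κ)), ecomp]
    exact h1
  simp only [mul_sub]
  rw [h1.tsum_sub h2, hshift, ← h1'.tsum_sub (by simpa only [mul_comm] using h2)]
  exact tsum_congr fun v => by ring

/-! ## §4 (F4) The labels one step away, and the gradient of the tent force along its own direction -/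

section Labels

variable {N : ℕ} [NeZero N]

omit [NeZero N] in
/-- [folklore] Off the step direction the label is unchanged: `(quo N (u + e_κ)) j = (quo N u) j`, `j ≠ κ`. -/
theorem quo_add_unitVec_apply_ne (u : Site (d + 1)) {κ j : Fin (d + 1)} (hj : j ≠ κ) : quo N (u + unitVec κ) j = quo N u j := by
  simp only [quo, Pi.add_apply, unitVec_apply, if_neg hj, add_zero]

/-- [folklore] Along the step direction the label does not decrease … -/
theorem quo_apply_le_quo_add_unitVec_apply (u : Site (d + 1)) (κ : Fin (d + 1)) : quo N u κ ≤ quo N (u + unitVec κ) κ := by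
  have hN : (0 : ℤ) < (N : ℤ) := by exact_mod_cast Nat.pos_of_ne_zero (NeZero.ne N)
  simp only [quo, Pi.add_apply, unitVec_apply, if_true]
  exact Int.ediv_le_ediv hN (by omega)

/-- [folklore] … and increases by at most one. -/
theorem quo_add_unitVec_apply_le (u : Site (d + 1)) (κ : Fin (d + 1)) : quo N (u + unitVec κ) κ ≤ quo N u κ + 1 := by
  have hN : (0 : ℤ) < (N : ℤ) := by exact_mod_cast Nat.pos_of_ne_zero (NeZero.ne N)
  have hN1 : (1 : ℤ) ≤ N := by exact_mod_cast Nat.one_le_iff_ne_zero.2 (NeZero.ne N)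
  simp only [quo, Pi.add_apply, unitVec_apply, if_true]
  have e : u κ / (N : ℤ) + 1 = (u κ + 1 * (N : ℤ)) / (N : ℤ) := by rw [Int.add_mul_ediv_right _ _ hN.ne']
  rw [e]
  exact Int.ediv_le_ediv hN (by linarith)

/-- [folklore] **ONE STEP MOVES THE LABEL BY AT MOST ONE**: `‖quo N (u + e_κ) − quo N u‖∞ ≤ 1`. -/
theorem supNorm_quo_add_unitVec_sub_le_one (u : Site (d + 1)) (κ : Fin (d + 1)) : supNorm (quo N (u + unitVec κ) - quo N u) ≤ 1 := by
  refine supNorm_le_of_forall fun j => ?_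
  rw [Pi.sub_apply]
  by_cases hj : j = κ
  · subst hj
    have h1 := quo_apply_le_quo_add_unitVec_apply (N := N) u j
    have h2 := quo_add_unitVec_apply_le (N := N) u j
    have : |quo N (u + unitVec j) j - quo N u j| ≤ 1 := abs_le.2 ⟨by linarith, by linarith⟩
    exact_mod_cast this
  · rw [quo_add_unitVec_apply_ne u hj, sub_self, abs_zero]; norm_num

/-- [folklore] `‖e_κ‖∞ ≤ 1`. -/
theorem supNorm_unitVec_le_one (κ : Fin (d + 1)) : supNorm (unitVec κ : Site (d + 1)) ≤ 1 :=
  supNorm_le_of_forall fun j => by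
    simp only [unitVec_apply]; split_ifs <;> simp

/-- [folklore] **(F4) THE GRADIENT OF THE TENT FORCE ALONG ITS OWN DIRECTION IS A COARSE DIFFERENCE**:
`contourSumAdj N φ κ (u + e_κ) − contourSumAdj N φ κ u = φ κ (quo N (u + e_κ)) − φ κ (quo N (u + e_κ) − e_κ)` — the `N`-term adjoint contour telescopes to its
two end labels (`contourSumAdj_eq`, `quo_add_zsmul`). -/
theorem contourSumAdj_add_unitVec_sub (φ : Form1 (d + 1) ℝ) (κ : Fin (d + 1)) (u : Site (d + 1)) :
    contourSumAdj N φ κ (u + unitVec κ) - contourSumAdj N φ κ u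
      = φ κ (quo N (u + unitVec κ)) - φ κ (quo N (u + unitVec κ) - unitVec κ) := by
  obtain ⟨M, hM⟩ : ∃ M, N = M + 1 := ⟨N - 1, (Nat.succ_pred_eq_of_ne_zero (NeZero.ne N)).symm⟩
  rw [contourSumAdj_eq, contourSumAdj_eq]
  have h1 : ∑ s ∈ Finset.range N, φ κ (quo N (u + unitVec κ - (s : ℤ) • unitVec κ))
      = φ κ (quo N (u + unitVec κ)) + ∑ s ∈ Finset.range M, φ κ (quo N (u - (s : ℤ) • unitVec κ)) := by
    rw [hM, Finset.sum_range_succ', Nat.cast_zero, zero_smul, sub_zero, add_comm]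
    congr 1
    refine Finset.sum_congr rfl fun s _ => ?_
    congr 2
    push_cast
    rw [add_smul, one_smul]
    abel
  have h2 : ∑ s ∈ Finset.range N, φ κ (quo N (u - (s : ℤ) • unitVec κ))
      = (∑ s ∈ Finset.range M, φ κ (quo N (u - (s : ℤ) • unitVec κ))) + φ κ (quo N (u - (M : ℤ) • unitVec κ)) := by
    rw [hM, Finset.sum_range_succ]
  have h3 : quo N (u - (M : ℤ) • unitVec κ) = quo N (u + unitVec κ) - unitVec κ := by
    have e : u - (M : ℤ) • unitVec κ = (u + unitVec κ) + (N : ℤ) • (-unitVec κ) := by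
      rw [hM]; push_cast; rw [smul_neg, add_smul, one_smul]; abel
    rw [e, quo_add_zsmul, sub_eq_add_neg]
  rw [h1, h2, h3]
  ring

/-- [folklore] **THE TENT FORCE's GRADIENT MASS IS `1∕N` OF ITS MASS**: under a coarse envelope `|φ κ y| ≤ Φ₀·e^{−κ₀‖y − y₀‖∞}` (`Φ₀, κ₀ ≥ 0`),
`|contourSumAdj N φ κ (u + e_κ) − contourSumAdj N φ κ u| ≤ 2Φ₀e^{2κ₀}·e^{−κ₀‖quo N u − y₀‖∞}` — NO factor `N` (compare `RemainderExplicitLaplacian.abs_contourSumAdj_le`: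
the force itself carries `N·Φ₀`). -/
theorem abs_contourSumAdj_add_unitVec_sub_le {φ : Form1 (d + 1) ℝ} {Φ₀ κ₀ : ℝ} (hΦ : 0 ≤ Φ₀) (hκ : 0 ≤ κ₀) (y₀ : Site (d + 1))
    (hφ : ∀ κ y, |φ κ y| ≤ Φ₀ * Real.exp (-(κ₀ * supNorm (y - y₀)))) (κ : Fin (d + 1)) (u : Site (d + 1)) :
    |contourSumAdj N φ κ (u + unitVec κ) - contourSumAdj N φ κ u| ≤ 2 * Φ₀ * Real.exp (2 * κ₀) * Real.exp (-(κ₀ * supNorm (quo N u - y₀))) := by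
  rw [contourSumAdj_add_unitVec_sub]
  set q := quo N (u + unitVec κ) with hq
  -- both labels are within sup-distance `2` of `quo N u`
  have hq1 : supNorm (quo N u - y₀) ≤ supNorm (q - y₀) + 2 := by
    have e : quo N u - y₀ = (q - y₀) + -(q - quo N u) := by abel
    have hn : supNorm (-(q - quo N u)) ≤ 1 := by
      refine supNorm_le_of_forall fun j => ?_
      have h := abs_le_supNorm (q - quo N u) j
      rw [Pi.neg_apply, abs_neg]
      exact h.trans (supNorm_quo_add_unitVec_sub_le_one (N := N) u κ)
    rw [e]; exact (supNorm_add_le _ _).trans (by linarith)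
  have hq2 : supNorm (quo N u - y₀) ≤ supNorm (q - unitVec κ - y₀) + 2 := by
    have e : quo N u - y₀ = (q - unitVec κ - y₀) + (unitVec κ + -(q - quo N u)) := by abel
    have hn : supNorm (unitVec κ + -(q - quo N u)) ≤ 2 := by
      have a := supNorm_unitVec_le_one (d := d) κ
      have b : supNorm (-(q - quo N u)) ≤ 1 := by
        refine supNorm_le_of_forall fun j => ?_
        have h := abs_le_supNorm (q - quo N u) j
        rw [Pi.neg_apply, abs_neg]
        exact h.trans (supNorm_quo_add_unitVec_sub_le_one (N := N) u κ)
      exact (supNorm_add_le _ _).trans (by linarith)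
    rw [e]; exact (supNorm_add_le _ _).trans (by linarith)
  have hb : ∀ y, supNorm (quo N u - y₀) ≤ supNorm (y - y₀) + 2 →
      |φ κ y| ≤ Φ₀ * Real.exp (2 * κ₀) * Real.exp (-(κ₀ * supNorm (quo N u - y₀))) := by
    intro y hy
    refine (hφ κ y).trans ?_
    rw [mul_assoc, ← Real.exp_add]
    refine mul_le_mul_of_nonneg_left (Real.exp_le_exp.2 ?_) hΦ
    nlinarith [mul_le_mul_of_nonneg_left hy hκ]
  calc |φ κ q - φ κ (q - unitVec κ)| ≤ |φ κ q| + |φ κ (q - unitVec κ)| := abs_sub _ _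
    _ ≤ Φ₀ * Real.exp (2 * κ₀) * Real.exp (-(κ₀ * supNorm (quo N u - y₀)))
        + Φ₀ * Real.exp (2 * κ₀) * Real.exp (-(κ₀ * supNorm (quo N u - y₀))) := add_le_add (hb q hq1) (hb _ hq2)
    _ = 2 * Φ₀ * Real.exp (2 * κ₀) * Real.exp (-(κ₀ * supNorm (quo N u - y₀))) := by ring

end Labels

/-! ## §5 One-step wobble of the block-scale envelopes; block-constancy of the envelopes on sub-blocks -/

/-- [folklore] `|e_κ|₁ = 1` on `ℤ^{d+1}`. -/
theorem l1_unitVec_eq_one (κ : Fin (d + 1)) : l1 (unitVec κ : Site (d + 1)) = 1 := by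
  unfold l1
  rw [Finset.sum_eq_single κ (fun j _ hj => by simp [unitVec_apply, hj]) (fun h => (h (Finset.mem_univ κ)).elim)]
  simp [unitVec_apply]

section Env

variable {N : ℕ} [NeZero N] {κ₀ : ℝ}

/-- [folklore] One step forward costs at most `e^{κ₀}` on a block-scale envelope. -/
theorem env_add_unitVec_le (hκ : 0 ≤ κ₀) (c u : Site (d + 1)) (κ : Fin (d + 1)) :
    Real.exp (-(κ₀ * supNorm (quo N (u + unitVec κ) - c))) ≤ Real.exp κ₀ * Real.exp (-(κ₀ * supNorm (quo N u - c))) := by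
  have h := env_wobble (d := d) (L := N) (Nat.one_le_iff_ne_zero.2 (NeZero.ne N)) hκ c u (u + unitVec κ)
  rwa [add_sub_cancel_left, l1_unitVec_eq_one, mul_one] at h

/-- [folklore] One step backward costs at most `e^{κ₀}`. -/
theorem env_sub_unitVec_le (hκ : 0 ≤ κ₀) (c u : Site (d + 1)) (κ : Fin (d + 1)) :
    Real.exp (-(κ₀ * supNorm (quo N (u - unitVec κ) - c))) ≤ Real.exp κ₀ * Real.exp (-(κ₀ * supNorm (quo N u - c))) := by
  have h := env_wobble (d := d) (L := N) (Nat.one_le_iff_ne_zero.2 (NeZero.ne N)) hκ c u (u - unitVec κ)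
  have e : l1 (u - unitVec κ - u) = 1 := by
    rw [show u - unitVec κ - u = -(unitVec κ : Site (d + 1)) by abel]
    unfold l1; simp only [Pi.neg_apply, Int.cast_neg, abs_neg]; exact l1_unitVec_eq_one (d := d) κ
  rwa [e, mul_one] at h

/-- [folklore] … and the envelope seen from one step forward: `E(u) ≤ e^{κ₀}·E(u + e_κ)`. -/
theorem env_le_exp_mul_env_add_unitVec (hκ : 0 ≤ κ₀) (c u : Site (d + 1)) (κ : Fin (d + 1)) :
    Real.exp (-(κ₀ * supNorm (quo N u - c))) ≤ Real.exp κ₀ * Real.exp (-(κ₀ * supNorm (quo N (u + unitVec κ) - c))) := by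
  have h := env_sub_unitVec_le (N := N) hκ c (u + unitVec κ) κ
  rwa [add_sub_cancel_right] at h

omit [NeZero N] in
/-- [folklore] Nested labels: `quo M (quo P x) = quo (P·M) x`. -/
theorem quo_quo (P M : ℕ) (x : Site (d + 1)) : quo M (quo P x) = quo (P * M) x := by
  funext j
  simp only [quo]
  push_cast
  exact Int.ediv_ediv_of_nonneg (Int.natCast_nonneg P)

omit [NeZero N] in
/-- [folklore] **THE BLOCK-SCALE ENVELOPES ARE CONSTANT ON EVERY SUB-BLOCK**: for `P ∣ N`, `quo N (P•w + r) = quo N (P•w)` (`r ∈ box P`). -/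
theorem quo_zsmul_add_toSite_of_dvd {P : ℕ} (hP : 1 ≤ P) (hPN : P ∣ N) (w : Site (d + 1)) {r : Fin (d + 1) → ℕ} (hr : r ∈ box (d + 1) P) :
    quo N ((P : ℤ) • w + toSite r) = quo N ((P : ℤ) • w) := by
  obtain ⟨M, hM⟩ := hPN
  haveI : NeZero P := ⟨by omega⟩
  have h0 : (fun _ : Fin (d + 1) => (0 : ℕ)) ∈ box (d + 1) P := Fintype.mem_piFinset.2 fun _ => Finset.mem_range.2 (by omega)
  have e0 : ((P : ℤ) • w) = (P : ℤ) • w + toSite (fun _ : Fin (d + 1) => (0 : ℕ)) := by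
    have : toSite (fun _ : Fin (d + 1) => (0 : ℕ)) = (0 : Site (d + 1)) := by funext j; simp [toSite]
    rw [this, add_zero]
  rw [hM, ← quo_quo, ← quo_quo, quo_zsmul_add_toSite w hr, e0, quo_zsmul_add_toSite w h0]

end Env

end Summit.QuantumFields.BalabanUV.Beta.GAN24.StaircaseFaces

end
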